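import Summits.FinalStateConjecture.FinalStateConjecture.Theses.KerrnessPropagates
import Literature.Geometry.Lorentzian.BackgroundChartCalculusLocal

/-!
# Route `KerrnessPropagates`, crux `KerrBasinCapture` (stmt-FinalStateConjecture-17646), line `registered`
# (skeleton `Cruxes/KerrBasinCapture/Lines/birth.lean`, lead rev 5) — stub `stub_orientationTransport`

Orientation transport along a flat preconnected subset of a hand-over slab.

A hand-over slab of the capture statement comes with a smooth open embedding `Φ : U → 𝒟` of a
neighbourhood `U` of the punctured hyperplane `{x⁰ = τ, r_j > r₀ j}` whose push-forward `Φ_*∂₀` is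
certified future-directed only on the far zone `{∀ j, R j − 1 ≤ r_j}`. This file transports that
orientation to every point of a preconnected subset `S` of the slab on which the pulled-back
metric is `C⁰`-pinched against `η` (`‖Φ^* g − η‖ < 1`, so `Φ_*∂₀` stays timelike and cannot change
time cone along `S`), provided `S` meets the far zone.

The proof is the library lemma
`Spacetime.isFutureDirected_mfderiv_basisVector_zero_of_isPreconnected_of_contMDiffOn`
(O'Neill 1983, Ch. 5, Lemma 5.26 ff.) applied on the open pinched piece
`W = U ∩ {‖Φ^* g − η‖ < 1}`; openness of `W` is continuity of the deviation on `U`, which is read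
off from the smoothness of the metric components of the parametrisation `Φ ∘ (chartAt E4 z)⁻¹`
(`Spacetime.contDiffOn_metricInCoords`) and the bridge "components minus background = deviation"
(`Spacetime.metricInCoords_comp_chartAt_symm_sub_eq_deviation`).
-/

open scoped BigOperators Topology Manifold Classical Matrix InnerProductSpace ContinuousMap
open Filter Set Function TopologicalSpace
open Literature.Geometry.Lorentzian

-- D-0017: single-problem summit, `Summit.<S>.<S>.…` by design.
set_option linter.dupNamespace false

namespace Summit.FinalStateConjecture.FinalStateConjecture.Theorems.KerrnessPropagates.KerrBasinCapture

-- the algebraic and the operator-norm instance paths on `E4 →L[ℝ] E4 →L[ℝ] ℝ` (model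
-- `E4 = PiLp 2 _`) unify slowly and need nested pending syntheses (as in `ADMEnergyPinning.lean`)
set_option maxSynthPendingDepth 3 in
set_option synthInstance.maxHeartbeats 200000 in
/-- **Continuity of the size of the extended deviation on the chart domain.** For a smooth chart
map `Φ : U → 𝓢` the norm `‖Φ^* g − η‖` of the zero-extended deviation is continuous on `U`: there
the deviation equals the metric components of the smooth parametrisation `Φ ∘ (chartAt E4 z)⁻¹`
minus the constant `η`. [folklore] -/
private theorem continuousOn_norm_deviationExtend_backgroundOn (𝓢 : Spacetime 4) {U : Opens E4}
    (Φ : U → 𝓢.carrier) (hΦ : ContMDiff 𝓘(ℝ, E4) (𝓡 4) (⊤ : ℕ∞) Φ) (z : U) :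
    ContinuousOn (fun y ↦ ‖𝓢.deviationExtend (Minkowski.backgroundOn U) Φ y‖) (U : Set E4) := by
  have hψ : ContMDiffOn 𝓘(ℝ, E4) (𝓡 4) (⊤ : ℕ∞) (Φ ∘ (chartAt E4 z).symm) (U : Set E4) :=
    𝓢.contMDiffOn_comp_chartAt_symm (Minkowski.backgroundOn U) Φ z hΦ
  have hG : ContDiffOn ℝ (⊤ : ℕ∞)
      (fun y ↦ 𝓢.metricInCoords (Φ ∘ (chartAt E4 z).symm) y - Minkowski.bilin) (U : Set E4) :=
    (𝓢.contDiffOn_metricInCoords U.isOpen hψ).sub contDiffOn_const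
  have heq : EqOn (𝓢.deviationExtend (Minkowski.backgroundOn U) Φ)
      (fun y ↦ 𝓢.metricInCoords (Φ ∘ (chartAt E4 z).symm) y - Minkowski.bilin) (U : Set E4) := by
    intro y hy
    have hd : MDifferentiableAt 𝓘(ℝ, E4) (𝓡 4) Φ ⟨y, hy⟩ :=
      (hΦ ⟨y, hy⟩).mdifferentiableAt (by simp)
    have e := 𝓢.metricInCoords_comp_chartAt_symm_sub_eq_deviation (Minkowski.backgroundOn U) Φ z hy hd
    rw [← 𝓢.deviationExtend_coe (Minkowski.backgroundOn U) Φ ⟨y, hy⟩] at e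
    exact e.symm
  exact (hG.continuousOn.congr heq).norm

/-- stub C2 — **ORIENTATION TRANSPORT** (registered stub of crux stmt-FinalStateConjecture-17646,
line `registered`). On a hand-over slab whose chart `Φ` is certified future-oriented on the far
zone `{∀ j, R j − 1 ≤ r_j}`, the push-forward `Φ_*∂₀` is future-directed at every point of a
preconnected subset `S` of the slab on which `‖Φ^* g − η‖ < 1`, as soon as `S` meets the far zone:
`Φ_*∂₀` is timelike along the pinched set, so its time cone is locally constant there
(O'Neill 1983, Ch. 5, Lemma 5.26 ff.). [folklore] -/
theorem stub_orientationTransport : ∀ k : ℕ, ∀ (X : Type) [TopologicalSpace X] [ChartedSpace E3 X] [IsManifold (𝓡 3) (⊤ : ℕ∞) X] [T2Space X] [SecondCountableTopology X] [ConnectedSpace X] (D : InitialDataSet (𝓡 3) X) (𝒟 : VacuumCauchyDevelopment D) (N : ℕ) (M a r₀ : Fin N → ℝ) (mo : Fin N → ↥lorentzGroup × E4) (ε τ : ℝ) (R : Fin N → ℝ) (U : Opens E4) (Φ : U → 𝒟.carrier), ((∀ i, r₀ i + 1 ≤ R i) ∧ ContMDiff 𝓘(ℝ, E4) (𝓡 4)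 (⊤ : ℕ∞) Φ ∧ Topology.IsOpenEmbedding Φ ∧ {x : E4 | x 0 = τ ∧ (∀ j, r₀ j < Kerr.radius (a j) (poincareInv (mo j).1 (mo j).2 x))} ⊆ (U : Set E4) ∧ range Φ ⊆ 𝒟.metric.causalFuture 𝒟.timeOrientation (range 𝒟.embed) ∧ 𝒟.metric.IsAchronal 𝒟.timeOrientation (Φ '' {x : ↥U | (x : E4) 0 = τ}) ∧ (∀ i, supCkENorm {x : E4 | x 0 = τ ∧ (∀ j, r₀ j < Kerr.radius (a j) (poincareInv (mo j).1 (mo j).2 x)) ∧ Kerr.radius (a i) (poincareInv (mo i).1 (mo i).2 x) ≤ R i} k (𝒟.toSpacetime.deviationExtend ⟨U, boostedKerrBilin (mo i).1 (mo i).2 (M i) (a i), fun x ↦ x 0, fun x ↦ Kerr.radius (a i) (poincareInv (mo i).1 (mo i).2 x)⟩ Φ) ≤ ENNReal.ofReal ε) ∧ supCkENorm {x : E4 | x 0 = τ ∧ (∀ j, r₀ j < Kerr.radius (a j) (poincareInv (mo j).1 (mo j).2 x)) ∧ ∀ j, R j - 1 ≤ Kerr.radius (a j) (poincareInv (mo j).1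 (mo j).2 x)} k (𝒟.toSpacetime.deviationExtend (Minkowski.backgroundOn U) Φ) ≤ ENNReal.ofReal ε ∧ (∀ x : ↥U, x.1 0 = τ → (∀ j, R j - 1 ≤ Kerr.radius (a j) (poincareInv (mo j).1 (mo j).2 x.1)) → 𝒟.timeOrientation.IsFutureDirected (mfderiv 𝓘(ℝ, E4) (𝓡 4) Φ x (E4.basisVector 0)))) → ∀ S : Set E4, IsPreconnected S → S ⊆ {x : E4 | x 0 = τ ∧ ∀ j, r₀ j < Kerr.radius (a j) (poincareInv (mo j).1 (mo j).2 x)} → (∀ x ∈ S, ‖𝒟.toSpacetime.deviationExtend (Minkowski.backgroundOn U) Φ x‖ < 1) → (∃ z₂ ∈ S, ∀ j, R j - 1 ≤ Kerr.radius (a j) (poincareInv (mo j).1 (mo j).2 z₂)) → ∀ x : ↥U, x.1 ∈ S → 𝒟.timeOrientation.IsFutureDirected (mfderiv 𝓘(ℝ, E4) (𝓡 4) Φ x (E4.basisVector 0)) := by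
  intro k X _ _ _ _ _ _ D 𝒟 N M a r₀ mo ε τ R U Φ hslab S hS hSsl hflat hz₂ x hx
  obtain ⟨-, hΦ, -, hU, -, -, -, -, hfut⟩ := hslab
  obtain ⟨z₂, hz₂S, hz₂far⟩ := hz₂
  have hz₂U : z₂ ∈ (U : Set E4) := hU (hSsl hz₂S)
  -- the open pinched piece `W = U ∩ {‖Φ^* g − η‖ < 1}`
  have hWo : IsOpen ((U : Set E4) ∩
      (fun y ↦ ‖𝒟.toSpacetime.deviationExtend (Minkowski.backgroundOn U) Φ y‖) ⁻¹' Iio 1) :=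
    (continuousOn_norm_deviationExtend_backgroundOn 𝒟.toSpacetime Φ hΦ
      ⟨z₂, hz₂U⟩).isOpen_inter_preimage U.isOpen isOpen_Iio
  exact 𝒟.toSpacetime.isFutureDirected_mfderiv_basisVector_zero_of_isPreconnected_of_contMDiffOn Φ
    hWo inter_subset_left hΦ.contMDiffOn (fun y hy ↦ hy.2) hS
    (fun y hy ↦ ⟨hU (hSsl hy), hflat y hy⟩) (z₁ := ⟨z₂, hz₂U⟩) hz₂S
    (hfut ⟨z₂, hz₂U⟩ (hSsl hz₂S).1 hz₂far) x hx

end Summit.FinalStateConjecture.FinalStateConjecture.Theorems.KerrnessPropagates.KerrBasinCapture
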